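import Mathlib
import Literature.FieldTheory.FiniteFields.CyclotomicExpandIrreducible
import Literature.Computability.Cryptography.PolynomialHashKWiseFamily
import Literature.Computability.Complexity.BoolEncodings
import HarnessLib

/-!
# An explicit `k`-wise independent hash family: Wegman–Carter polynomials over `GF(2^{2·3^j}) = 𝔽₂[X]/(X^{2·3^j} + X^{3^j} + 1)`

The tree's `PolynomialHash.isKWiseIndepFamily_polyHash` (`PolynomialHashKWiseFamily.lean`) proves that polynomial
evaluation hashing over ANY finite field `F` with a balanced output bit is a `k`-wise independent family of oracles
(tree predicate `IsKWiseIndepFamily`, `QuantumComplexity/BoundedIndependenceOracles.lean`), leaving open "a concrete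
choice of `(F = GF(2^ℓ), ι, κ, φ)`". This file makes that choice with NO arbitrary data (every map is given by an
explicit formula, so that an evaluation machine can later be written against it):

* the field `BinField j = AdjoinRoot (modulus j)`, `modulus j = X^{2·3^j} + X^{3^j} + 1 = Q₃(X^{3^j}) ∈ 𝔽₂[X]`,
  IRREDUCIBLE for every `j` (Menezes et al., Exercise 3.2 with `r = 3`, `q = 2` — the tree's
  `CyclotomicExpandIrreducible.irreducible_expand_cyclotomic`; equivalently van Lint's Theorem 1.1.28), of dimension
  `dim j = 2·3^j`; coordinates `coordEquiv j` in the power basis `1, x, …, x^{dim j − 1}` (the class of `p` has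
  coordinates the coefficients of `p mod modulus j`, `coordEquiv_mk`), read as bits through `Fin 2 ≃ Bool`
  (`bitsEquiv j`);
* the string embedding `embed j u` = the field element with bit vector `padBits (dim j) u = u ++ 1 ++ 0…0`
  (injective on the strings of length `< dim j`, `embed_injOn`);
* the output bit `outBit j z` = coordinate `0` of `z` (balanced: `two_mul_card_filter_apply_eq_true` transported
  along `bitsEquiv j`);
* the key decoding `keySplit j k N`: a key of `N ≥ k·dim j` bits is read as `k` consecutive blocks of `dim j` bits
  (the coefficients `c₀, …, c_{k−1}` of the hash polynomial `P_c = Σ c_t X^t`) followed by `N − k·dim j` ignored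
  surplus bits (uniform fibres, `card_filter_keySplit_fst`);
* the family `family j k N key = {u | outBit j (P_c(embed j u)) = 1}` and **`isKWiseIndepFamily_family`**: it is
  `k`-wise independent on the strings of length `≤ m` whenever `k·dim j ≤ N`, `m + 1 ≤ dim j` and `k ≤ 2^{dim j}`;
* standard parameters `level k m = ⌊log₃(k+m+1)⌋ + 1` (so `2(k+m+1) < dim ≤ 6(k+m+1)`), key length
  `keyPoly = 6(X+1)²` evaluated at `k + m`, `stdFamily k m`, **`isKWiseIndepFamily_stdFamily`** (all `k, m`);
* ONE keyed language `hashLang = {⟨⟨1ᵏ, key⟩, u⟩ | u ∈ stdFamily k m key}` (`m` is determined by `k` and the key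
  length), `mem_hashLang_iff`, **`isKWiseIndepFamily_hashLang`**, and `exists_explicit_family_of_mem_P`: explicit
  `k`-wise independent hashing in `P` in the keyed form used by the quantum-advantage cruxes follows from the single
  complexity statement `hashLang ∈ P` (the evaluation machine — carry-less multiplication modulo `modulus j` — is
  NOT built here).

Sources: M. N. Wegman, J. L. Carter, JCSS 22 (1981) §3 (polynomial hashing, strongly universal_k)
[cite: WegmanCarter1981, §3]; N. Alon, L. Babai, A. Itai, J. Algorithms 7 (1986) §2 (k-wise independent variables
from polynomials over finite fields) [cite: AlonBabaiItai1986, §2]; A. J. Menezes (ed.) et al., Applications of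
Finite Fields (1993), Ch. 3 Exercise 3.2 (the irreducible family `Q_r(x^{r^k})`) [cite: BlakeEtAl1993, Ch. 3 Exercise 3.2].
-/

noncomputable section

namespace Literature.Computability.Cryptography.ExplicitKWiseHash

open Finset Polynomial Literature.Computability.QuantumComplexity Literature.Computability.Complexity
  Literature.Computability.Cryptography.PolynomialHash

/-! ### The explicit binary fields `𝔽₂[X]/(X^{2·3^j} + X^{3^j} + 1)` -/

/-- The modulus `Q₃(X^{3^j}) = X^{2·3^j} + X^{3^j} + 1 ∈ 𝔽₂[X]`. [cite: BlakeEtAl1993, Ch. 3 Exercise 3.2] -/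
def modulus (j : ℕ) : (ZMod 2)[X] :=
  expand (ZMod 2) (3 ^ j) (cyclotomic 3 (ZMod 2))

/-- `modulus j = X^{2·3^j} + X^{3^j} + 1`. [cite: BlakeEtAl1993, Ch. 3 Exercise 3.2] -/
theorem modulus_eq (j : ℕ) : modulus j = X ^ (2 * 3 ^ j) + X ^ (3 ^ j) + 1 := by
  rw [modulus, Literature.FieldTheory.FiniteFields.CyclotomicExpandIrreducible.expand_cyclotomic_eq_sum
    Nat.prime_three]
  simp only [Finset.sum_range_succ, Finset.sum_range_zero, zero_mul, pow_zero, one_mul, zero_add]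
  ring

/-- The modulus is monic. [cite: BlakeEtAl1993, Ch. 3 Exercise 3.2] -/
theorem monic_modulus (j : ℕ) : (modulus j).Monic :=
  (monic_expand_iff (pow_pos (by norm_num) j)).2 (cyclotomic.monic 3 (ZMod 2))

/-- The modulus has degree `2·3^j`. [cite: BlakeEtAl1993, Ch. 3 Exercise 3.2] -/
theorem natDegree_modulus (j : ℕ) : (modulus j).natDegree = 2 * 3 ^ j := by
  rw [modulus, natDegree_expand, natDegree_cyclotomic, Nat.totient_prime Nat.prime_three]

/-- **The modulus is irreducible over `𝔽₂`** (Menezes et al., Exercise 3.2 with `r = 3`, `q = 2`: `2` is primitive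
modulo `3` and `9 ∤ 2² − 1`). [cite: BlakeEtAl1993, Ch. 3 Exercise 3.2] -/
theorem irreducible_modulus (j : ℕ) : Irreducible (modulus j) := by
  refine Literature.FieldTheory.FiniteFields.CyclotomicExpandIrreducible.irreducible_expand_cyclotomic
    (F := ZMod 2) Nat.prime_three (by norm_num) ?_ ?_ j
  · rw [ZMod.card]
    refine ⟨⟨by norm_num, by decide⟩, ?_⟩
    rintro k ⟨hk, hmod⟩
    by_contra hlt
    push Not at hlt
    interval_cases k
    exact absurd hmod (by decide)
  · rw [ZMod.card]
    decide

/-- The field `GF(2^{2·3^j})` presented as `𝔽₂[X]/(modulus j)`. [cite: BlakeEtAl1993, Ch. 3 Exercise 3.2] -/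
abbrev BinField (j : ℕ) : Type := AdjoinRoot (modulus j)

/-- The dimension `dim j = deg (modulus j)` (`= 2·3^j`). [cite: BlakeEtAl1993, Ch. 3 Exercise 3.2] -/
def dim (j : ℕ) : ℕ := (modulus j).natDegree

/-- `dim j = 2·3^j`. [cite: BlakeEtAl1993, Ch. 3 Exercise 3.2] -/
theorem dim_eq (j : ℕ) : dim j = 2 * 3 ^ j := natDegree_modulus j

/-- `0 < dim j`. [cite: BlakeEtAl1993, Ch. 3 Exercise 3.2] -/
theorem dim_pos (j : ℕ) : 0 < dim j := by
  rw [dim_eq]; positivity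

/-- `dim j < 2 ^ dim j`. [folklore] -/
private theorem dim_lt_two_pow (j : ℕ) : dim j < 2 ^ dim j := Nat.lt_two_pow_self

/-- Coordinates in the power basis `1, x, …, x^{dim j − 1}` of `𝔽₂[X]/(modulus j)` (Mathlib's
`AdjoinRoot.powerBasisAux'`). [cite: BlakeEtAl1993, Ch. 3 Exercise 3.2] -/
def coordEquiv (j : ℕ) : BinField j ≃ (Fin (dim j) → ZMod 2) :=
  (AdjoinRoot.powerBasisAux' (monic_modulus j)).equivFun.toEquiv

/-- The coordinates of the class of `p` are the coefficients of `p mod (modulus j)` (unique representative of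
degree `< dim j`). [cite: LidlNiederreiter1996, Thm. 1.86] -/
theorem coordEquiv_mk (j : ℕ) (p : (ZMod 2)[X]) (i : Fin (dim j)) :
    coordEquiv j (AdjoinRoot.mk (modulus j) p) i = (p %ₘ modulus j).coeff i := by
  change (AdjoinRoot.powerBasisAux' (monic_modulus j)).repr (AdjoinRoot.mk (modulus j) p) i = _
  rw [AdjoinRoot.powerBasisAux'_repr_apply_to_fun, AdjoinRoot.modByMonicHom_mk]

/-- The element with coordinates `c` is the class of `Σ_i c_i X^i`. [cite: LidlNiederreiter1996, Thm. 1.86] -/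
theorem coordEquiv_symm_apply (j : ℕ) (c : Fin (dim j) → ZMod 2) :
    (coordEquiv j).symm c = AdjoinRoot.mk (modulus j) (∑ i : Fin (dim j), monomial (i : ℕ) (c i)) := by
  rw [coordEquiv, AdjoinRoot.powerBasisAux', Module.Basis.equivFun_ofEquivFun]
  rfl

/-- `𝔽₂ ≃ Bool` (`0 ↦ false`, `1 ↦ true`). [folklore] -/
def bitEquiv : ZMod 2 ≃ Bool := finTwoEquiv

/-- Field elements as bit vectors of length `dim j` (coordinates read through `bitEquiv`). [folklore] -/
def bitsEquiv (j : ℕ) : BinField j ≃ (Fin (dim j) → Bool) :=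
  (coordEquiv j).trans ((Equiv.refl (Fin (dim j))).arrowCongr bitEquiv)

/-- `bitsEquiv j z i = bitEquiv (coordEquiv j z i)`. [cite: LidlNiederreiter1996, Thm. 1.86] -/
theorem bitsEquiv_apply (j : ℕ) (z : BinField j) (i : Fin (dim j)) :
    bitsEquiv j z i = bitEquiv (coordEquiv j z i) := rfl

/-! ### String embedding, output bit, key decoding -/

/-- The bit vector `u ++ 1 ++ 0^{d − |u| − 1}` of a string `u` (for `|u| < d`): the standard injective padding
of variable-length strings into a fixed-length universe. [cite: WegmanCarter1981, §3] -/
def padBits (d : ℕ) (u : List Bool) : Fin d → Bool :=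
  fun i => if h : (i : ℕ) < u.length then u[(i : ℕ)] else decide ((i : ℕ) = u.length)

/-- `padBits d` is injective on the strings of length `< d` (the last `1` marks the length).
[cite: WegmanCarter1981, §3] -/
theorem padBits_injOn (d : ℕ) : Set.InjOn (padBits d) {u : List Bool | u.length < d} := by
  intro u hu v hv h
  simp only [Set.mem_setOf_eq] at hu hv
  have hlen : u.length = v.length := by
    by_contra hne
    rcases Nat.lt_or_gt_of_ne hne with hlt | hlt
    · have := congrFun h ⟨v.length, hv⟩
      have h1 : ¬ v.length < u.length := by omega
      have h2 : ¬ v.length = u.length := by omega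
      simp [padBits, h1, h2] at this
    · have := congrFun h ⟨u.length, hu⟩
      have h1 : ¬ u.length < v.length := by omega
      have h2 : ¬ u.length = v.length := by omega
      simp [padBits, h1, h2] at this
  refine List.ext_getElem hlen fun i h1 h2 => ?_
  have := congrFun h ⟨i, by omega⟩
  simpa [padBits, h1, h2] using this

/-- The string embedding `ι`: `u ↦` the field element with bit vector `padBits (dim j) u`. [cite: WegmanCarter1981, §3] -/
def embed (j : ℕ) (u : List Bool) : BinField j :=
  (bitsEquiv j).symm (padBits (dim j) u)

/-- The embedding is injective on the strings of length `≤ m` as soon as `m + 1 ≤ dim j`.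
[cite: WegmanCarter1981, §3] -/
theorem embed_injOn (j : ℕ) {m : ℕ} (hm : m + 1 ≤ dim j) :
    Set.InjOn (embed j) (shortStrings (m + 1) : Finset (List Bool)) := by
  intro u hu v hv h
  have hu' : u.length < dim j := by
    have := mem_shortStrings.1 (Finset.mem_coe.1 hu); omega
  have hv' : v.length < dim j := by
    have := mem_shortStrings.1 (Finset.mem_coe.1 hv); omega
  exact padBits_injOn (dim j) hu' hv' ((bitsEquiv j).symm.injective h)

/-- The output bit `φ`: coordinate `0` (the constant coefficient of the reduced representative). [cite: WegmanCarter1981, §3] -/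
def outBit (j : ℕ) (z : BinField j) : Bool :=
  bitsEquiv j z ⟨0, dim_pos j⟩

/-- Bit vectors with a prescribed `true` at one position are exactly half. [folklore] -/
private theorem two_mul_card_filter_apply_eq_true {d : ℕ} (i : Fin d) :
    2 * #(univ.filter fun v : Fin d → Bool => v i = true) = 2 ^ d := by
  -- the flip of bit `i` exchanges the two halves
  set σ : (Fin d → Bool) → (Fin d → Bool) := fun v => Function.update v i (!v i) with hσ
  have hinv : Function.Involutive σ := by
    intro v
    simp only [hσ]
    ext i'
    by_cases hi : i' = i
    · subst hi; simp
    · simp [Function.update_of_ne hi]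
  have hhalf : #(univ.filter fun v : Fin d → Bool => v i = true) =
      #(univ.filter fun v : Fin d → Bool => ¬ v i = true) := by
    refine Finset.card_equiv hinv.toPerm fun v => ?_
    simp only [mem_filter, mem_univ, true_and, Function.Involutive.coe_toPerm, hσ,
      Function.update_self]
    rcases Bool.eq_false_or_eq_true (v i) with hv | hv <;> simp [hv]
  have htot := Finset.card_filter_add_card_filter_not
    (s := (univ : Finset (Fin d → Bool))) (fun v : Fin d → Bool => v i = true)
  rw [← hhalf, Finset.card_univ, Fintype.card_pi, Fintype.card_bool, Finset.prod_const,
    Finset.card_univ, Fintype.card_fin] at htot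
  omega

/-- The key decoding `κ` together with the surplus bits: a key of `N ≥ k·dim j` bits is `k` blocks of `dim j` bits
(the coefficients, block `t`, bit `b` at position `b + dim j · t`) followed by `N − k·dim j` surplus bits.
[cite: WegmanCarter1981, §3] -/
def keySplit (j k N : ℕ) (h : k * dim j ≤ N) :
    (Fin N → Bool) ≃ (Fin k → BinField j) × (Fin (N - k * dim j) → Bool) :=
  (((finCongr (by omega : N = k * dim j + (N - k * dim j))).trans finSumFinEquiv.symm).arrowCongr
      (Equiv.refl Bool)).trans <|
    (Equiv.sumArrowEquivProdArrow _ _ _).trans <|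
      Equiv.prodCongr
        (((finProdFinEquiv (m := k) (n := dim j)).symm.arrowCongr (Equiv.refl Bool)).trans <|
          (Equiv.curry _ _ _).trans (Equiv.piCongrRight fun _ => (bitsEquiv j).symm))
        (Equiv.refl _)

/-- Block `t`, bit `b` of the decoded coefficient vector is key bit `b + dim j · t`. [cite: WegmanCarter1981, §3] -/
theorem bitsEquiv_keySplit_fst (j k N : ℕ) (h : k * dim j ≤ N) (key : Fin N → Bool) (t : Fin k)
    (b : Fin (dim j)) :
    bitsEquiv j ((keySplit j k N h key).1 t) b =
      key ⟨(b : ℕ) + dim j * t, lt_of_lt_of_le (finProdFinEquiv (t, b)).2 h⟩ := by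
  have h1 : (keySplit j k N h key).1 t =
      (bitsEquiv j).symm fun b => key ⟨(b : ℕ) + dim j * t, lt_of_lt_of_le (finProdFinEquiv (t, b)).2 h⟩ :=
    rfl
  rw [h1, Equiv.apply_symm_apply]

/-- **Uniform fibres of the key decoding**: every coefficient vector arises from exactly `2^{N − k·dim j}` keys.
[cite: WegmanCarter1981, §3] -/
theorem card_filter_keySplit_fst (j k N : ℕ) (h : k * dim j ≤ N) [DecidableEq (BinField j)]
    (c : Fin k → BinField j) :
    #(univ.filter fun key : Fin N → Bool => (keySplit j k N h key).1 = c) = 2 ^ (N - k * dim j) := by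
  letI : Fintype (BinField j) := Fintype.ofEquiv _ (bitsEquiv j).symm
  have h1 : #(univ.filter fun key : Fin N → Bool => (keySplit j k N h key).1 = c) =
      #(univ.filter fun p : (Fin k → BinField j) × (Fin (N - k * dim j) → Bool) => p.1 = c) :=
    Finset.card_equiv (keySplit j k N h) fun key => by simp only [mem_filter, mem_univ, true_and]
  have h2 : (univ.filter fun p : (Fin k → BinField j) × (Fin (N - k * dim j) → Bool) => p.1 = c) =
      ({c} : Finset (Fin k → BinField j)) ×ˢ (univ : Finset (Fin (N - k * dim j) → Bool)) := by
    ext p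
    simp only [mem_filter, mem_univ, true_and, mem_product, mem_singleton, and_true]
  rw [h1, h2, card_product, card_singleton, one_mul, card_univ, Fintype.card_pi, Fintype.card_bool,
    prod_const, card_univ, Fintype.card_fin]

/-! ### The family and its `k`-wise independence -/

/-- **The explicit hash family** with field level `j`, independence parameter `k` and key length `N`:
`key ↦ {u | outBit j (P_c (embed j u)) = true}`, `c = (keySplit j k N key).1` the decoded coefficient vector,
`P_c = Σ_{t<k} c_t X^t` (junk `∅` if `N < k·dim j`). [cite: WegmanCarter1981, §3] [cite: AlonBabaiItai1986, §2] -/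
def family (j k N : ℕ) (key : Fin N → Bool) : Set (List Bool) :=
  if h : k * dim j ≤ N then
    {u : List Bool | outBit j ((((degreeLTEquiv (BinField j) k).symm ((keySplit j k N h key).1) :
      degreeLT (BinField j) k) : (BinField j)[X]).eval (embed j u)) = true}
  else ∅

/-- **`k`-wise independence of the explicit family.** If `k·dim j ≤ N` (enough key bits), `m + 1 ≤ dim j` (the
strings of length `≤ m` embed injectively) and `k ≤ 2^{dim j}` (at most `|F|` evaluation points are constrained),
then `family j k N` is `k`-wise independent on the strings of length `≤ m` under a uniform `N`-bit key.
[cite: WegmanCarter1981, §3] [cite: AlonBabaiItai1986, §2] -/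
theorem isKWiseIndepFamily_family (j k N m : ℕ) (hN : k * dim j ≤ N) (hm : m + 1 ≤ dim j)
    (hk : k ≤ 2 ^ dim j) : IsKWiseIndepFamily (family j k N) (shortStrings (m + 1)) k := by
  classical
  letI : Fact (Irreducible (modulus j)) := ⟨irreducible_modulus j⟩
  letI : Fintype (BinField j) := Fintype.ofEquiv _ (bitsEquiv j).symm
  have hcard : Fintype.card (BinField j) = 2 ^ dim j := by
    rw [Fintype.ofEquiv_card, Fintype.card_pi, Fintype.card_bool, prod_const, card_univ, Fintype.card_fin]
  have hφ : 2 * #(univ.filter fun z : BinField j => outBit j z = true) = Fintype.card (BinField j) := by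
    have : #(univ.filter fun z : BinField j => outBit j z = true) =
        #(univ.filter fun v : Fin (dim j) → Bool => v ⟨0, dim_pos j⟩ = true) :=
      Finset.card_equiv (bitsEquiv j) fun z => by simp only [mem_filter, mem_univ, true_and, outBit]
    rw [this, two_mul_card_filter_apply_eq_true, hcard]
  have h := isKWiseIndepFamily_polyHash (F := BinField j) (K := Fin N → Bool) k (hcard ▸ hk)
    (fun key => (keySplit j k N hN key).1) (2 ^ (N - k * dim j)) (card_filter_keySplit_fst j k N hN)
    (shortStrings (m + 1)) (embed j) (embed_injOn j hm) (outBit j) hφ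
  have hfam : family j k N = fun key => {u : List Bool | outBit j ((((degreeLTEquiv (BinField j) k).symm
      ((keySplit j k N hN key).1) : degreeLT (BinField j) k) : (BinField j)[X]).eval (embed j u)) = true} := by
    funext key
    rw [family, dif_pos hN]
  rw [hfam]
  exact h

/-! ### Standard parameters: field level `⌊log₃(k+m+1)⌋ + 1`, key length `6(k+m+1)²` -/

/-- The field level used for independence `k` on the strings of length `≤ m` (universe of size `≥` number of
points and `≥ k`). [cite: WegmanCarter1981, §3] -/
def level (k m : ℕ) : ℕ := Nat.log 3 (k + m + 1) + 1

/-- `2(k+m+1) < dim (level k m)` (the universe is large enough). [cite: WegmanCarter1981, §3] -/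
theorem two_mul_lt_dim_level (k m : ℕ) : 2 * (k + m + 1) < dim (level k m) := by
  rw [dim_eq, level]
  have := Nat.lt_pow_succ_log_self (b := 3) (by norm_num) (k + m + 1)
  rw [Nat.succ_eq_add_one] at this
  omega

/-- `dim (level k m) ≤ 6(k+m+1)` (the universe is polynomially small). [cite: WegmanCarter1981, §3] -/
theorem dim_level_le (k m : ℕ) : dim (level k m) ≤ 6 * (k + m + 1) := by
  rw [dim_eq, level, pow_succ]
  have := Nat.pow_log_le_self 3 (x := k + m + 1) (by omega)
  omega

/-- The key-length polynomial `6(X+1)²` (`k` coefficients of `dim ≤ 6(k+m+1)` bits each).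
[cite: WegmanCarter1981, §3] -/
def keyPoly : Polynomial ℕ := 6 * (X + 1) ^ 2

/-- `keyPoly (n) = 6(n+1)²`. [cite: WegmanCarter1981, §3] -/
theorem keyPoly_eval (n : ℕ) : keyPoly.eval n = 6 * (n + 1) ^ 2 := by
  simp [keyPoly]

/-- Enough key bits: `k · dim (level k m) ≤ 6(k+m+1)²`. [cite: WegmanCarter1981, §3] -/
theorem mul_dim_level_le (k m : ℕ) : k * dim (level k m) ≤ keyPoly.eval (k + m) := by
  rw [keyPoly_eval]
  calc k * dim (level k m) ≤ (k + m + 1) * (6 * (k + m + 1)) :=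
        Nat.mul_le_mul (by omega) (dim_level_le k m)
    _ = 6 * (k + m + 1) ^ 2 := by ring

/-- The strings of length `≤ m` embed: `m + 1 ≤ dim (level k m)`. [cite: WegmanCarter1981, §3] -/
theorem succ_le_dim_level (k m : ℕ) : m + 1 ≤ dim (level k m) := by
  have := two_mul_lt_dim_level k m; omega

/-- `k ≤ 2 ^ dim (level k m)` (at most `|F|` points are ever constrained). [cite: WegmanCarter1981, §3] -/
theorem le_two_pow_dim_level (k m : ℕ) : k ≤ 2 ^ dim (level k m) := by
  have h1 := two_mul_lt_dim_level k m
  have h2 := dim_lt_two_pow (level k m)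
  omega

/-- **The standard explicit family** for independence `k` on the strings of length `≤ m`: keys of `6(k+m+1)²` bits,
field `GF(2^{dim (level k m)})`. [cite: WegmanCarter1981, §3] [cite: AlonBabaiItai1986, §2] -/
def stdFamily (k m : ℕ) (key : Fin (keyPoly.eval (k + m)) → Bool) : Set (List Bool) :=
  family (level k m) k (keyPoly.eval (k + m)) key

/-- **The standard family is `k`-wise independent on the strings of length `≤ m`, for all `k, m`.**
[cite: WegmanCarter1981, §3] [cite: AlonBabaiItai1986, §2] -/
theorem isKWiseIndepFamily_stdFamily (k m : ℕ) : IsKWiseIndepFamily (stdFamily k m) (shortStrings (m + 1)) k :=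
  isKWiseIndepFamily_family (level k m) k (keyPoly.eval (k + m)) m (mul_dim_level_le k m)
    (succ_le_dim_level k m) (le_two_pow_dim_level k m)

/-! ### One keyed language -/

/-- **The keyed hash language** `{⟨⟨1ᵏ, key⟩, u⟩ | u ∈ stdFamily k m key}` (`key` of `6(k+m+1)²` bits, which
determines `m` given `k`). [cite: WegmanCarter1981, §3] -/
def hashLang : Language Bool :=
  {w : List Bool | ∃ (k m : ℕ) (key : Fin (keyPoly.eval (k + m)) → Bool) (u : List Bool),
    w = boolPair (boolPair (List.replicate k true) (List.ofFn key)) u ∧ u ∈ stdFamily k m key}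

/-- `keyPoly` is injective: `6(a+1)² = 6(b+1)² → a = b`. [folklore] -/
private theorem keyPoly_eval_injective : Function.Injective fun n : ℕ => keyPoly.eval n := by
  intro a b h
  simp only [keyPoly_eval] at h
  have h' : (a + 1) ^ 2 = (b + 1) ^ 2 := by omega
  have := Nat.pow_left_injective (n := 2) (by norm_num) h'
  simpa using this

/-- Decoding the keyed language: `⟨⟨1ᵏ, key⟩, u⟩ ∈ hashLang ↔ u ∈ stdFamily k m key` (the pairing is injective
and the key length determines `m`). [cite: WegmanCarter1981, §3] -/
theorem mem_hashLang_iff (k m : ℕ) (key : Fin (keyPoly.eval (k + m)) → Bool) (u : List Bool) :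
    boolPair (boolPair (List.replicate k true) (List.ofFn key)) u ∈ hashLang ↔ u ∈ stdFamily k m key := by
  constructor
  · rintro ⟨k', m', key', u', hw, hu'⟩
    have h1 := boolPair_injective (a₁ := (boolPair (List.replicate k true) (List.ofFn key), u))
      (a₂ := (boolPair (List.replicate k' true) (List.ofFn key'), u')) hw
    obtain ⟨h2, rfl⟩ := Prod.mk.inj h1
    have h3 := boolPair_injective (a₁ := (List.replicate k true, List.ofFn key))
      (a₂ := (List.replicate k' true, List.ofFn key')) h2
    obtain ⟨h4, h5⟩ := Prod.mk.inj h3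
    have hk : k = k' := by simpa using congrArg List.length h4
    subst hk
    have hm : m = m' := by
      have hl := congrArg List.length h5
      simp only [List.length_ofFn] at hl
      have := keyPoly_eval_injective hl
      omega
    subst hm
    have hkey : key = key' := List.ofFn_injective h5
    subst hkey
    exact hu'
  · intro hu
    exact ⟨k, m, key, u, rfl, hu⟩

/-- **The keyed language presents the standard family**: for all `k, m`, the family
`key ↦ {u | ⟨⟨1ᵏ, key⟩, u⟩ ∈ hashLang}` over uniform keys of `keyPoly (k+m)` bits is `k`-wise independent on the
strings of length `≤ m`. [cite: WegmanCarter1981, §3] [cite: AlonBabaiItai1986, §2] -/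
theorem isKWiseIndepFamily_hashLang (k m : ℕ) :
    IsKWiseIndepFamily
      (fun key : Fin (keyPoly.eval (k + m)) → Bool =>
        {u : List Bool | boolPair (boolPair (List.replicate k true) (List.ofFn key)) u ∈ hashLang})
      (shortStrings (m + 1)) k := by
  have hfam : (fun key : Fin (keyPoly.eval (k + m)) → Bool =>
      {u : List Bool | boolPair (boolPair (List.replicate k true) (List.ofFn key)) u ∈ hashLang}) =
      stdFamily k m := by
    funext key
    ext u
    exact mem_hashLang_iff k m key u
  rw [hfam]
  exact isKWiseIndepFamily_stdFamily k m

/-- **Explicit `k`-wise independent hashing in `P`, reduced to one complexity statement.** If `hashLang ∈ P`, then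
there are a language `H ∈ P` and a key-length polynomial `t` such that for all `k, m` the family
`key ↦ {u | ⟨⟨1ᵏ, key⟩, u⟩ ∈ H}` over uniform keys of `t(k+m)` bits is `k`-wise independent on the strings of length
`≤ m` (witnesses: `H = hashLang`, `t = 6(X+1)²`). [cite: WegmanCarter1981, §3] [cite: AlonBabaiItai1986, §2] -/
theorem exists_explicit_family_of_mem_P (hP : hashLang ∈ Classes.P) :
    ∃ H ∈ Classes.P, ∃ t : Polynomial ℕ, ∀ k m : ℕ,
      IsKWiseIndepFamily
        (fun key : Fin (t.eval (k + m)) → Bool =>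
          {u : List Bool | boolPair (boolPair (List.replicate k true) (List.ofFn key)) u ∈ H})
        (shortStrings (m + 1)) k :=
  ⟨hashLang, hP, keyPoly, isKWiseIndepFamily_hashLang⟩

end Literature.Computability.Cryptography.ExplicitKWiseHash

end
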